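import Mathlib
import Literature.Computability.AlgebraicComplexity.MatrixMultiplicationExponent

/-!
# The vertex rank law (stub `stub_vertexRankLaw`) — Mathlib-only proof

Line `vertex-flattening-factor-rank` for the crux `FidelityWitnesses.DiagonalPowerDecay`
(`stmt-MatrixMultiplication-14053`), harvested as a support by the lead of line
`unit-tensor-orbit-nuclear-ratio`.

For a matrix `X` on the vertex space `(Fin n)³`, the tensor `♯X` with entry
`X (a.1, b.2, c.2) (b.1, c.1, a.2)` at `(a, b, c)` satisfies `⟨♯X, ⟨n,n,n⟩⟩ = tr X`
(`vrl_capture_eq_trace`) and `‖♯X‖² = ‖X‖_F²` (`vrl_normSq_eq`), so the stub is the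
VERTEX RANK LAW for square complex matrices: `|tr X|² ≤ rank X · ‖X‖_F²` (`vrl_norm_trace_sq_le`).

Proof of the law.  View `X` as the operator `T = toEuclideanLin X` on `E = EuclideanSpace ℂ m` and let
`K = range T` (`finrank K = rank X`, `Matrix.rank_eq_finrank_range_toLin`).  Since `T` maps into `K`,
`tr X = tr T = tr (T|_K)` (`LinearMap.trace_restrict_eq_of_forall_mem`), and over an orthonormal basis
`b` of `K` (`stdOrthonormalBasis`), `tr (T|_K) = Σ_i ⟪b i, T (b i)⟫` (`LinearMap.trace_eq_sum_inner`),
a sum of `rank X` terms each of modulus `≤ ‖T (b i)‖`.  Cauchy–Schwarz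
(`sq_sum_le_card_mul_sum_sq`) gives `|tr X|² ≤ rank X · Σ_i ‖T (b i)‖²`, and Bessel's inequality for
the orthonormal family `b` (`Orthonormal.sum_inner_products_le`), applied to the conjugated rows of `X`
(`(T v) r = ⟪conj (row r), v⟫`), gives `Σ_i ‖T (b i)‖² ≤ Σ_r ‖row r‖² = ‖X‖_F²`.
Mathlib only (+ the tree definition `matMulTensor`).
-/

set_option linter.dupNamespace false

namespace Summit.MatrixMultiplication.MatrixMultiplication.Theorems.DiagonalPowerDecay

open Literature.Computability.AlgebraicComplexity
open scoped BigOperators Matrix InnerProductSpace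

/-- **Vertex rank law, matrix form.** For a square complex matrix `X`,
`‖tr X‖² ≤ rank X · Σ_{r,c} ‖X r c‖²` (`= rank X · ‖X‖_F²`). -/
theorem vrl_norm_trace_sq_le {m : Type*} [Fintype m] [DecidableEq m] (X : Matrix m m ℂ) :
    ‖X.trace‖ ^ 2 ≤ (X.rank : ℝ) * ∑ r, ∑ c, ‖X r c‖ ^ 2 := by
  classical
  -- the matrix as an operator on Euclidean space, its range `K`, an orthonormal basis `b` of `K`
  set T : EuclideanSpace ℂ m →ₗ[ℂ] EuclideanSpace ℂ m := Matrix.toEuclideanLin X with hTdef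
  set K : Submodule ℂ (EuclideanSpace ℂ m) := LinearMap.range T with hKdef
  set b : OrthonormalBasis (Fin (Module.finrank ℂ K)) ℂ K := stdOrthonormalBasis ℂ K with hbdef
  -- `rank X = finrank K`
  have hrank : X.rank = Module.finrank ℂ K :=
    Matrix.rank_eq_finrank_range_toLin X (EuclideanSpace.basisFun m ℂ).toBasis
      (EuclideanSpace.basisFun m ℂ).toBasis
  -- `tr X = tr T = tr (T|_K) = Σ_i ⟪b i, T (b i)⟫`
  have hmem : ∀ x, T x ∈ K := fun x => LinearMap.mem_range_self T x
  have htrace : X.trace = ∑ i, ⟪(b i : EuclideanSpace ℂ m), T (b i)⟫_ℂ := by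
    have h1 : X.trace = LinearMap.trace ℂ _ T :=
      (Matrix.trace_toLin_eq X (EuclideanSpace.basisFun m ℂ).toBasis).symm
    have h2 := LinearMap.trace_restrict_eq_of_forall_mem K T hmem
    have h3 := LinearMap.trace_eq_sum_inner (T.restrict fun x _ => hmem x) b
    rw [h1, ← h2, h3]
    refine Finset.sum_congr rfl fun i _ => ?_
    rw [Submodule.coe_inner, LinearMap.coe_restrict_apply]
  -- each term has modulus at most `‖T (b i)‖`
  have hterm : ∀ i, ‖⟪(b i : EuclideanSpace ℂ m), T (b i)⟫_ℂ‖ ≤ ‖T (b i)‖ := by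
    intro i
    calc ‖⟪(b i : EuclideanSpace ℂ m), T (b i)⟫_ℂ‖
        ≤ ‖(b i : EuclideanSpace ℂ m)‖ * ‖T (b i)‖ := norm_inner_le_norm _ _
      _ = ‖T (b i)‖ := by rw [Submodule.norm_coe, b.orthonormal.1 i, one_mul]
  -- the family `b` is orthonormal in `E`
  have hon : Orthonormal ℂ (fun i => (b i : EuclideanSpace ℂ m)) := by
    rw [orthonormal_iff_ite]
    intro i j
    rw [← Submodule.coe_inner, orthonormal_iff_ite.mp b.orthonormal i j]
  -- `(T v) r` is the inner product of `v` with the conjugated row `r`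
  have hTv : ∀ (v : EuclideanSpace ℂ m) (r : m),
      (T v) r = ⟪WithLp.toLp 2 (star (X r)), v⟫_ℂ := by
    intro v r
    rw [EuclideanSpace.inner_eq_star_dotProduct, WithLp.ofLp_toLp, star_star, dotProduct_comm]
    rfl
  -- Bessel: `Σ_i ‖T (b i)‖² ≤ ‖X‖_F²`
  have hbessel : ∑ i, ‖T (b i)‖ ^ 2 ≤ ∑ r, ∑ c, ‖X r c‖ ^ 2 := by
    calc ∑ i, ‖T (b i)‖ ^ 2
        = ∑ i, ∑ r, ‖⟪WithLp.toLp 2 (star (X r)), (b i : EuclideanSpace ℂ m)⟫_ℂ‖ ^ 2 := by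
          refine Finset.sum_congr rfl fun i _ => ?_
          rw [EuclideanSpace.norm_sq_eq]
          refine Finset.sum_congr rfl fun r _ => ?_
          rw [hTv]
      _ = ∑ r, ∑ i, ‖⟪(b i : EuclideanSpace ℂ m), WithLp.toLp 2 (star (X r))⟫_ℂ‖ ^ 2 := by
          rw [Finset.sum_comm]
          refine Finset.sum_congr rfl fun r _ => Finset.sum_congr rfl fun i _ => ?_
          rw [norm_inner_symm]
      _ ≤ ∑ r, ‖(WithLp.toLp 2 (star (X r)) : EuclideanSpace ℂ m)‖ ^ 2 :=
          Finset.sum_le_sum fun r _ => hon.sum_inner_products_le _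
      _ = ∑ r, ∑ c, ‖X r c‖ ^ 2 := by
          refine Finset.sum_congr rfl fun r _ => ?_
          rw [EuclideanSpace.norm_sq_eq]
          refine Finset.sum_congr rfl fun c _ => ?_
          rw [PiLp.toLp_apply, Pi.star_apply, norm_star]
  -- `card (Fin (finrank K)) = rank X`
  have hcard : ((Finset.univ : Finset (Fin (Module.finrank ℂ K))).card : ℝ) = X.rank := by
    rw [Finset.card_univ, Fintype.card_fin, hrank]
  -- assemble: `|Σ_i z_i|² ≤ card · Σ_i |z_i|² ≤ rank X · Σ_i ‖T (b i)‖² ≤ rank X · ‖X‖_F²`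
  calc ‖X.trace‖ ^ 2
      = ‖∑ i, ⟪(b i : EuclideanSpace ℂ m), T (b i)⟫_ℂ‖ ^ 2 := by rw [htrace]
    _ ≤ (∑ i, ‖⟪(b i : EuclideanSpace ℂ m), T (b i)⟫_ℂ‖) ^ 2 :=
        pow_le_pow_left₀ (norm_nonneg _) (norm_sum_le _ _) 2
    _ ≤ ((Finset.univ : Finset (Fin (Module.finrank ℂ K))).card : ℝ) *
          ∑ i, ‖⟪(b i : EuclideanSpace ℂ m), T (b i)⟫_ℂ‖ ^ 2 :=
        sq_sum_le_card_mul_sum_sq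
    _ ≤ (X.rank : ℝ) * ∑ i, ‖T (b i)‖ ^ 2 := by
        rw [hcard]
        exact mul_le_mul_of_nonneg_left
          (Finset.sum_le_sum fun i _ => pow_le_pow_left₀ (norm_nonneg _) (hterm i) 2)
          (Nat.cast_nonneg _)
    _ ≤ (X.rank : ℝ) * ∑ r, ∑ c, ‖X r c‖ ^ 2 :=
        mul_le_mul_of_nonneg_left hbessel (Nat.cast_nonneg _)

/-- **Dictionary, capture side:** the capture of `♯X` against `⟨n,n,n⟩` is the trace of `X`,
`Σ_{a,b,c} X (a.1,b.2,c.2) (b.1,c.1,a.2) · ⟨n,n,n⟩_{abc} = tr X`. -/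
theorem vrl_capture_eq_trace (n : ℕ) (X : Matrix (Fin n × Fin n × Fin n) (Fin n × Fin n × Fin n) ℂ) :
    (∑ a : Fin n × Fin n, ∑ b : Fin n × Fin n, ∑ c : Fin n × Fin n,
        X (a.1, b.2, c.2) (b.1, c.1, a.2) * matMulTensor ℂ n n n a b c) = X.trace := by
  -- adapted from Cruxes/DiagonalPowerDecay/Lines/vertex_flattening_factor_rank.lean (capture_unflat)
  classical
  have key : ∀ a : Fin n × Fin n, (∑ b : Fin n × Fin n, ∑ c : Fin n × Fin n,
      X (a.1, b.2, c.2) (b.1, c.1, a.2) * matMulTensor ℂ n n n a b c) =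
      ∑ j : Fin n, X (a.1, j, a.2) (a.1, j, a.2) := by
    intro a
    have hb : ∀ b : Fin n × Fin n, (∑ c : Fin n × Fin n,
        X (a.1, b.2, c.2) (b.1, c.1, a.2) * matMulTensor ℂ n n n a b c) =
        if a.1 = b.1 then X (a.1, b.2, a.2) (b.1, b.2, a.2) else 0 := by
      intro b
      by_cases hab : a.1 = b.1
      · rw [if_pos hab, Finset.sum_eq_single (b.2, a.2)]
        · simp [matMulTensor, hab]
        · intro c _ hc
          simp only [matMulTensor]
          rw [if_neg, mul_zero]
          rintro ⟨-, h2, h3⟩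
          exact hc (Prod.ext h2.symm h3.symm)
        · intro h; exact absurd (Finset.mem_univ _) h
      · rw [if_neg hab]
        exact Finset.sum_eq_zero fun c _ => by simp [matMulTensor, hab]
    simp_rw [hb]
    rw [Fintype.sum_prod_type, Finset.sum_comm]
    simp only [Finset.sum_ite_eq, Finset.mem_univ, if_true]
  simp_rw [key]
  simp only [Matrix.trace, Matrix.diag, Fintype.sum_prod_type]
  exact Finset.sum_congr rfl fun i _ => Finset.sum_comm

/-- **Dictionary, norm side:** `‖♯X‖² = ‖X‖_F²`, i.e.
`Σ_{a,b,c} ‖X (a.1,b.2,c.2) (b.1,c.1,a.2)‖² = Σ_{r,c} ‖X r c‖²` (the index map is a bijection). -/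
theorem vrl_normSq_eq (n : ℕ) (X : Matrix (Fin n × Fin n × Fin n) (Fin n × Fin n × Fin n) ℂ) :
    (∑ a : Fin n × Fin n, ∑ b : Fin n × Fin n, ∑ c : Fin n × Fin n,
        ‖X (a.1, b.2, c.2) (b.1, c.1, a.2)‖ ^ 2) = ∑ r, ∑ c, ‖X r c‖ ^ 2 := by
  -- adapted from Cruxes/DiagonalPowerDecay/Lines/vertex_flattening_factor_rank.lean (normSq_unflat)
  -- reindex `(a,b,c) ↦ ((a.1,b.2,c.2),(b.1,c.1,a.2))`, a bijection `P × P × P ≃ V × V`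
  let e : (Fin n × Fin n) × (Fin n × Fin n) × (Fin n × Fin n) ≃
      (Fin n × Fin n × Fin n) × (Fin n × Fin n × Fin n) :=
    { toFun := fun x => ((x.1.1, x.2.1.2, x.2.2.2), (x.2.1.1, x.2.2.1, x.1.2))
      invFun := fun y => ((y.1.1, y.2.2.2), (y.2.1, y.1.2.1), (y.2.2.1, y.1.2.2))
      left_inv := fun x => rfl
      right_inv := fun y => rfl }
  have h1 : (∑ a : Fin n × Fin n, ∑ b : Fin n × Fin n, ∑ c : Fin n × Fin n,
        ‖X (a.1, b.2, c.2) (b.1, c.1, a.2)‖ ^ 2) =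
      ∑ x : (Fin n × Fin n) × (Fin n × Fin n) × (Fin n × Fin n),
        ‖X (x.1.1, x.2.1.2, x.2.2.2) (x.2.1.1, x.2.2.1, x.1.2)‖ ^ 2 := by
    simp only [Fintype.sum_prod_type]
  have h2 : (∑ r : Fin n × Fin n × Fin n, ∑ c : Fin n × Fin n × Fin n, ‖X r c‖ ^ 2) =
      ∑ y : (Fin n × Fin n × Fin n) × (Fin n × Fin n × Fin n), ‖X y.1 y.2‖ ^ 2 := by
    simp only [Fintype.sum_prod_type]
  rw [h1, h2, ← Equiv.sum_comp e]
  rfl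

/-- **Stub `stub_vertexRankLaw` — the VERTEX RANK LAW.** For every matrix `X` on the vertex space
`(Fin n)³`, the tensor `♯X` (entry `X (a.1,b.2,c.2) (b.1,c.1,a.2)` at `(a,b,c)`) captures at most
`rank X` of its squared norm against `⟨n,n,n⟩`: `|⟨♯X, ⟨n,n,n⟩⟩|² ≤ rank X · ‖♯X‖²`, i.e.
`|tr X|² ≤ rank X · ‖X‖_F²` (`vrl_capture_eq_trace`, `vrl_normSq_eq`, `vrl_norm_trace_sq_le`). -/
theorem stub_vertexRankLaw (n : ℕ) (X : Matrix (Fin n × Fin n × Fin n) (Fin n × Fin n × Fin n) ℂ) :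
    ‖∑ a : Fin n × Fin n, ∑ b : Fin n × Fin n, ∑ c : Fin n × Fin n,
        X (a.1, b.2, c.2) (b.1, c.1, a.2) * matMulTensor ℂ n n n a b c‖ ^ 2
      ≤ (X.rank : ℝ) *
        ∑ a : Fin n × Fin n, ∑ b : Fin n × Fin n, ∑ c : Fin n × Fin n,
          ‖X (a.1, b.2, c.2) (b.1, c.1, a.2)‖ ^ 2 := by
  rw [vrl_capture_eq_trace, vrl_normSq_eq]
  exact vrl_norm_trace_sq_le X

end Summit.MatrixMultiplication.MatrixMultiplication.Theorems.DiagonalPowerDecay
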